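import Summits.QuantumFields.BalabanUV.Beta.GAN24.RespStepBm
import Summits.QuantumFields.BalabanUV.Beta.GAN24.RespStepBmGaugeStep
import Summits.QuantumFields.BalabanUV.Beta.GAN24.RespStepDecay
import Summits.QuantumFields.BalabanUV.Beta.GAN24.Push4Iter

/-!
# `BalabanUV.Beta.GAN24.RespStepBmDecompLegs` — binder row G-an2-4 / (CONV-C), S-slot road «SREC» on the literal of record (family (E)),
# PART V row V4-c (`SKELETON-SREC` v0.2/v0.3 SR-L4a; RULINGS-16 (R16-3) «SREC-DECOMP», part 1 of 3): THE ACTION OF LEG FAMILIES ON SUMMABLE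
# COARSE DATA — `legAct`, the class `LegL1` (bounded, uniformly `ℓ¹`), Fubini for composite legs, and an2's `respStep` ∕ its `Π_bm`-window in the class

NOT IN PRINT; OUR BOOKKEEPING (G-an2-4 formalisation swarm, leaf prover `b2b-balaban-gan24-formalise-leaf-03`, gen 41; the row owner
`b2b-balaban-gan24-p1` gen 13's RULINGS-16 addendum (R16-3), journal `CLAIMS.log` l.18387, claim l.18445; names PROVISIONAL — the owner may
rename / re-cut).  HONEST FRAMING (cell contract, verbatim): «discharging `BetaPertH` makes Bałaban's UV stability UNCONDITIONAL — a real
constructive-QFT result; it is NOT the continuum limit and NOT the Clay problem.»  HONEST DEPENDENCY (verbatim): «continuum YM on T⁴ ⇐ BetaPertH ∧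
nine spine estimates (0/9 proved); BetaPertH ⇐ (D1) ∧ (D4) ∧ CAP+tail; G-an2-4 gates asym, D1 and NE2/3/4.»

WHAT.  Row V4-c is the kernel form of the owner's observation (C2)/O13-1 (`S-REC-SIZING.md` v2 §v2-2): the composite DRESSED legs of the (E)
recursion, `T_{m→n} := legChain D m k` (`n = m+k+1`, `D j := respStepBm ρ Lc (Lc^j) (Lc^(j+1))` = `Π^ρ_bm ∘ 𝒬_{Lc^j} ℋ_{Lc^{j+1}}`, leaf-01's
`RespStepBm`, leaf-17's `Push4Iter.legChain`), decompose as `Π_m ∘ respStep (Lc^m) (Lc^n) + dz ∘ Ψ_{m,n}` with `Ψ` DISPLAYED (part 3,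
`RespStepBmDecomp`; part 2 `RespStepBmDecompExact` = the exact-datum law through the chains).  This part is the `ℓ¹` plumbing, free of any decay
ESTIMATE and of any restriction on `d`:
* `legAct r b κ u := Σ_μ Σ'_y b μ y · r μ y κ u` — a leg family ACTING on a coarse datum (the owner's spec); the class `LegL1 r C T` (bounded by `C`,
  uniformly `ℓ¹` in the FINE index with bound `T`; a predicate with parameters, like leaf-17's `Push4Bounds.LegDecay`, of which it is a consequence:
  `legL1_of_legDecay`); the Tonelli brick `summable_uncurry_of_majorant` (`summable_prod_of_nonneg`); `summable_legAct` (`ℓ¹ → ℓ¹`), `legAct_sub` ∕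
  `legAct_smul`, `legAct_respStep_self` (the identity leg, leaf-12's `RespStepSemigroup.respStep_self`), `abs_legComp_le` (a composite of a bounded
  leg after an `ℓ¹` leg is bounded), **`legAct_legComp`**: `legAct (legComp r₂ r₁) b = legAct r₂ (legAct r₁ b)` — first `r₁` acts, then `r₂`
  (Fubini, `Summable.tsum_comm`, under `Summable (b μ)`, `LegL1 r₁`, `|r₂| ≤ C₂`).
* **`exists_legL1_respStep`**: an2's response family `respStep M N′` (`N′ = M·L`) IS IN THE CLASS — bounded (gan24-p4's
  `RespStepBmGaugeStep.exists_abs_respStep_le`), summable in the fine index (an2's `summable_respStep`), and the `ℓ¹` mass is independent of the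
  source bond by leaf-12's joint block covariance `RespStepDecay.respStep_translate` — NO DECAY RATE is used (the (N1)-type estimates of
  `RespStepDecay` §3 are not touched); **`legL1_bmW`**: leaf-01's window `bmW (toSite rr) N` keeps the class (constants `× cWb d N`; an2's `abs_pmBm_le`).
[folklore] throughout: one plumbing `def` (`legAct`) and one predicate with parameters (`LegL1`); tree theorems BY NAME.  0 cited facts,
0 `def … : Prop` fact, 0 sorry.  NO estimate; asserts NO shape of Bałaban's stencils; discharges NOTHING of (hS, hSall) on (E); 0 wall binders;
NEVER «G-an2-4 closed»; NOT D1, NOT BetaPertH, NOT continuum, NOT Clay.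
-/

noncomputable section

open Finset
open scoped BigOperators
open Literature.MathematicalPhysics.QuantumFieldTheory
open Literature.MathematicalPhysics.QuantumFieldTheory.Balaban1983to89
open Literature.MathematicalPhysics.QuantumFieldTheory.Balaban1983to89.Beta
open B12Sec2to5 (l1 l1_nonneg)
open ExpKernelCalculus (Zl summable_exp_shift' tsum_exp_shift')
open AffineAveraging (Form0 Form1 Site box toSite unitVec)
open KKTFluctuationEnergy (summable_mul_of_bdd summable_mul_of_bdd' summable_shift_sub)
open BalabanCompositeJets (respStep summable_respStep)
open Summit.QuantumFields.BalabanUV.Beta.AxialDressingRooted (cube pmBm abs_pmBm_le card_cube cWb)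
open Summit.QuantumFields.BalabanUV.Beta.GAN24.Push4 (legComp legComp_apply)
open Summit.QuantumFields.BalabanUV.Beta.GAN24.Push4Bounds (LegDecay LegDecay.abs_le LegDecay.summable)
open Summit.QuantumFields.BalabanUV.Beta.GAN24.Push4Iter (LegFam)
open Summit.QuantumFields.BalabanUV.Beta.GAN24.RespStepSemigroup (respStep_self)
open Summit.QuantumFields.BalabanUV.Beta.GAN24.RespStepBm (bmW bmW_apply)
open Summit.QuantumFields.BalabanUV.Beta.GAN24.RespStepBmGaugeStep (exists_abs_respStep_le)
open Summit.QuantumFields.BalabanUV.Beta.GAN24.RespStepDecay (respStep_translate)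

namespace Summit.QuantumFields.BalabanUV.Beta.GAN24.RespStepBmDecompLegs

variable {d : ℕ}

/-! ## §1 The action of a leg family on a summable coarse datum; the class `LegL1` -/

/-- [our object] **THE ACTION OF A LEG FAMILY ON A COARSE DATUM**: `legAct r b κ u := Σ_μ Σ'_y b μ y · r μ y κ u` — the fine 1-form obtained by
superposing the legs `r μ y` with the (summable) coarse weights `b μ y`. -/
def legAct (r : LegFam d) (b : Form1 (d + 1) ℝ) : Form1 (d + 1) ℝ := fun κ u => ∑ μ, ∑' y, b μ y * r μ y κ u

/-- [folklore] `legAct`, by `rfl`. -/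
theorem legAct_apply (r : LegFam d) (b : Form1 (d + 1) ℝ) (κ : Fin (d + 1)) (u : Site (d + 1)) :
    legAct r b κ u = ∑ μ, ∑' y, b μ y * r μ y κ u := rfl

/-- [our object] **A LEG FAMILY BOUNDED AND UNIFORMLY `ℓ¹` IN ITS FINE INDEX**: `|r μ y κ u| ≤ C` and `Σ'_u |r μ y κ u| ≤ T` for every coarse bond
`(μ, y)` and every `κ` (a predicate with parameters; `LegDecay` legs, an2's `respStep M N′` and their `Π_bm`-windows are instances). -/
def LegL1 (r : LegFam d) (C T : ℝ) : Prop :=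
  (∀ μ y κ u, |r μ y κ u| ≤ C) ∧ ∀ μ y κ, Summable (r μ y κ) ∧ ∑' u, |r μ y κ u| ≤ T

namespace LegL1

variable {r : LegFam d} {C T : ℝ}

/-- [folklore] The uniform bound. -/
theorem abs_le (h : LegL1 r C T) (μ : Fin (d + 1)) (y : Site (d + 1)) (κ : Fin (d + 1)) (u : Site (d + 1)) : |r μ y κ u| ≤ C :=
  h.1 μ y κ u

/-- [folklore] Summability in the fine index. -/
theorem summable (h : LegL1 r C T) (μ : Fin (d + 1)) (y : Site (d + 1)) (κ : Fin (d + 1)) : Summable (r μ y κ) :=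
  (h.2 μ y κ).1

/-- [folklore] Absolute summability in the fine index. -/
theorem summable_abs (h : LegL1 r C T) (μ : Fin (d + 1)) (y : Site (d + 1)) (κ : Fin (d + 1)) :
    Summable fun u => |r μ y κ u| :=
  (h.summable μ y κ).abs

/-- [folklore] The uniform `ℓ¹` bound. -/
theorem tsum_abs_le (h : LegL1 r C T) (μ : Fin (d + 1)) (y : Site (d + 1)) (κ : Fin (d + 1)) : ∑' u, |r μ y κ u| ≤ T :=
  (h.2 μ y κ).2

/-- [folklore] `0 ≤ C`. -/
theorem nonneg (h : LegL1 r C T) : 0 ≤ C := (abs_nonneg _).trans (h.1 0 0 0 0)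

/-- [folklore] `0 ≤ T`. -/
theorem nonneg' (h : LegL1 r C T) : 0 ≤ T := (tsum_nonneg fun _ => abs_nonneg _).trans (h.tsum_abs_le 0 0 0)

end LegL1

/-- [folklore] `|Σ' f| ≤ Σ' |f|` for a summable real family on the lattice. -/
theorem abs_tsum_le_tsum_abs {f : Site (d + 1) → ℝ} (hf : Summable f) : |∑' y, f y| ≤ ∑' y, |f y| := by
  have h := norm_tsum_le_tsum_norm (f := f) (by simpa only [Real.norm_eq_abs] using hf.abs)
  simpa only [Real.norm_eq_abs] using h

/-- [folklore] **TONELLI BRICK** on `ℤ^{d+1} × ℤ^{d+1}`: a nonnegative `G` with summable slices `G y ·` whose sums are dominated by a summable `φ y`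
is summable on the product, and so is every `F` with `|F| ≤ G`. -/
theorem summable_uncurry_of_majorant {F G : Site (d + 1) → Site (d + 1) → ℝ} (hG0 : ∀ y v, 0 ≤ G y v) (hGs : ∀ y, Summable (G y))
    {φ : Site (d + 1) → ℝ} (hφ : Summable φ) (hGle : ∀ y, ∑' v, G y v ≤ φ y) (hFG : ∀ y v, |F y v| ≤ G y v) :
    Summable (Function.uncurry F) ∧ Summable (Function.uncurry G) := by
  have hG : Summable (Function.uncurry G) :=
    (summable_prod_of_nonneg (fun p => hG0 p.1 p.2)).2
      ⟨fun y => hGs y, Summable.of_nonneg_of_le (fun y => tsum_nonneg (hG0 y)) hGle hφ⟩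
  exact ⟨Summable.of_norm_bounded hG (fun p => by rw [Real.norm_eq_abs]; exact hFG p.1 p.2), hG⟩

/-- [folklore] A leg family localised at a positive rate (`Push4Bounds.LegDecay`) is in the class, `T = C · Zl (d+1) m`. -/
theorem legL1_of_legDecay {r : LegFam d} {N : ℕ} {C m : ℝ} (h : LegDecay r N C m) (hm : 0 < m) : LegL1 r C (C * Zl (d + 1) m) := by
  refine ⟨fun μ y κ u => h.abs_le hm.le μ y κ u, fun μ y κ => ⟨h.summable hm μ y κ, ?_⟩⟩
  have hs := (summable_exp_shift' hm ((N : ℤ) • y)).mul_left C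
  calc ∑' u, |r μ y κ u| ≤ ∑' u, C * Real.exp (-m * l1 (u - (N : ℤ) • y)) :=
        Summable.tsum_le_tsum (fun u => h μ y κ u) (h.summable hm μ y κ).abs hs
    _ = C * Zl (d + 1) m := by rw [tsum_mul_left, tsum_exp_shift']

/-- [folklore] The slices `y ↦ b μ y · r μ y κ u` of a summable datum against a bounded leg are summable. -/
theorem summable_slice {b : Form1 (d + 1) ℝ} (hb : ∀ μ, Summable (b μ)) {r : LegFam d} {C : ℝ} (hr : ∀ μ y κ u, |r μ y κ u| ≤ C)
    (μ κ : Fin (d + 1)) (u : Site (d + 1)) : Summable fun y => b μ y * r μ y κ u :=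
  summable_mul_of_bdd' (hb μ) (fun y => hr μ y κ u)

/-- [folklore] **THE MAJORANT OF `legAct`**: `(y, u) ↦ b μ y · r μ y κ u` is summable on the product (summable datum, `LegL1` leg). -/
theorem summable_uncurry_legAct {b : Form1 (d + 1) ℝ} (hb : ∀ μ, Summable (b μ)) {r : LegFam d} {C T : ℝ} (hr : LegL1 r C T)
    (μ κ : Fin (d + 1)) :
    Summable (Function.uncurry fun y u => b μ y * r μ y κ u) ∧ Summable (Function.uncurry fun y u => |b μ y| * |r μ y κ u|) := by
  refine summable_uncurry_of_majorant (F := fun y u => b μ y * r μ y κ u) (G := fun y u => |b μ y| * |r μ y κ u|)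
    (fun y u => mul_nonneg (abs_nonneg _) (abs_nonneg _)) (fun y => (hr.summable_abs μ y κ).mul_left _)
    ((hb μ).abs.mul_right T) (fun y => ?_) (fun y u => by rw [abs_mul])
  show ∑' u, |b μ y| * |r μ y κ u| ≤ |b μ y| * T
  rw [tsum_mul_left]
  exact mul_le_mul_of_nonneg_left (hr.tsum_abs_le μ y κ) (abs_nonneg _)

/-- [folklore] **`legAct` IS `ℓ¹ → ℓ¹`**: for a summable datum and a `LegL1` leg family, every component `legAct r b κ` is summable. -/
theorem summable_legAct {b : Form1 (d + 1) ℝ} (hb : ∀ μ, Summable (b μ)) {r : LegFam d} {C T : ℝ} (hr : LegL1 r C T) (κ : Fin (d + 1)) :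
    Summable (legAct r b κ) := by
  show Summable fun u => ∑ μ ∈ Finset.univ, ∑' y, b μ y * r μ y κ u
  refine summable_sum fun μ _ => ?_
  have hmaj : Summable fun u => ∑' y, |b μ y| * |r μ y κ u| := (summable_uncurry_legAct hb hr μ κ).2.prod_symm.prod
  refine Summable.of_norm_bounded hmaj fun u => ?_
  rw [Real.norm_eq_abs]
  refine (abs_tsum_le_tsum_abs (summable_slice hb hr.1 μ κ u)).trans (le_of_eq (tsum_congr fun y => abs_mul _ _))

/-- [folklore] `legAct` is subtractive in the datum (summable data, bounded leg). -/
theorem legAct_sub {b₁ b₂ : Form1 (d + 1) ℝ} (hb₁ : ∀ μ, Summable (b₁ μ)) (hb₂ : ∀ μ, Summable (b₂ μ)) {r : LegFam d} {C : ℝ}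
    (hr : ∀ μ y κ u, |r μ y κ u| ≤ C) : legAct r (b₁ - b₂) = legAct r b₁ - legAct r b₂ := by
  funext κ u
  simp only [legAct_apply, Pi.sub_apply, sub_mul]
  rw [← Finset.sum_sub_distrib]
  exact Finset.sum_congr rfl fun μ _ => (summable_slice hb₁ hr μ κ u).tsum_sub (summable_slice hb₂ hr μ κ u)

/-- [folklore] `legAct` is homogeneous in the datum. -/
theorem legAct_smul (r : LegFam d) (c : ℝ) (b : Form1 (d + 1) ℝ) : legAct r (c • b) = c • legAct r b := by
  funext κ u
  simp only [legAct_apply, Pi.smul_apply, smul_eq_mul, Finset.mul_sum, ← tsum_mul_left, mul_assoc]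

/-- [folklore] **THE IDENTITY LEG**: `legAct (respStep M M) b = b` (leaf-12's `respStep_self`: `respStep M M μ y κ u = [u = y ∧ κ = μ]`). -/
theorem legAct_respStep_self (M : ℕ) [NeZero M] (b : Form1 (d + 1) ℝ) : legAct (respStep (d := d) M M) b = b := by
  funext κ u
  simp only [legAct_apply, respStep_self]
  rw [Finset.sum_eq_single_of_mem κ (Finset.mem_univ κ) (fun μ _ hμ => ?_)]
  · rw [tsum_eq_single u (fun y hy => by rw [if_neg (fun h => hy h.1.symm), mul_zero])]
    rw [if_pos ⟨rfl, rfl⟩, mul_one]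
  · refine (tsum_congr fun y => ?_).trans tsum_zero
    rw [if_neg (fun h => hμ h.2.symm), mul_zero]

/-- [folklore] **A COMPOSITE LEG IS BOUNDED**: `|legComp r₂ r₁ μ y κ u| ≤ (d+1) · T₁ · C₂` (`r₁` uniformly `ℓ¹` in its fine = the middle index, `r₂` bounded). -/
theorem abs_legComp_le {r₁ r₂ : LegFam d} {C₁ T₁ C₂ : ℝ} (h₁ : LegL1 r₁ C₁ T₁) (h₂ : ∀ lam v κ u, |r₂ lam v κ u| ≤ C₂)
    (μ : Fin (d + 1)) (y : Site (d + 1)) (κ : Fin (d + 1)) (u : Site (d + 1)) :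
    |legComp r₂ r₁ μ y κ u| ≤ ((d : ℝ) + 1) * T₁ * C₂ := by
  have hC₂ : 0 ≤ C₂ := (abs_nonneg _).trans (h₂ 0 0 0 0)
  rw [legComp_apply]
  have hs : ∀ lam, Summable fun v => |r₁ μ y lam v| * C₂ := fun lam => (h₁.summable_abs μ y lam).mul_right _
  have hsum : Summable fun v => ∑ lam, r₁ μ y lam v * r₂ lam v κ u :=
    summable_sum fun lam _ => summable_mul_of_bdd' (h₁.summable μ y lam) (fun v => h₂ lam v κ u)
  calc |∑' v, ∑ lam, r₁ μ y lam v * r₂ lam v κ u| ≤ ∑' v, |∑ lam, r₁ μ y lam v * r₂ lam v κ u| := abs_tsum_le_tsum_abs hsum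
    _ ≤ ∑' v, ∑ lam, |r₁ μ y lam v| * C₂ :=
        Summable.tsum_le_tsum (fun v => (Finset.abs_sum_le_sum_abs _ _).trans (Finset.sum_le_sum fun lam _ => by
          rw [abs_mul]; exact mul_le_mul_of_nonneg_left (h₂ lam v κ u) (abs_nonneg _))) hsum.abs (summable_sum fun lam _ => hs lam)
    _ = ∑ lam, (∑' v, |r₁ μ y lam v|) * C₂ := by
        rw [Summable.tsum_finsetSum (fun lam _ => hs lam)]
        exact Finset.sum_congr rfl fun lam _ => tsum_mul_right
    _ ≤ ∑ _lam : Fin (d + 1), T₁ * C₂ := Finset.sum_le_sum fun lam _ => mul_le_mul_of_nonneg_right (h₁.tsum_abs_le μ y lam) hC₂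
    _ = ((d : ℝ) + 1) * T₁ * C₂ := by
        rw [Finset.sum_const, Finset.card_univ, Fintype.card_fin, nsmul_eq_mul]; push_cast; ring

/-- [folklore] **FUBINI FOR THE ACTION OF A COMPOSITE LEG**: `legAct (legComp r₂ r₁) b = legAct r₂ (legAct r₁ b)` — first `r₁` acts on the coarse
datum, then `r₂` (summable datum, `r₁ ∈ LegL1`, `r₂` bounded: the triple family `(y, v) ↦ b μ y · r₁ μ y λ v · r₂ λ v κ u` is absolutely summable). -/
theorem legAct_legComp {b : Form1 (d + 1) ℝ} (hb : ∀ μ, Summable (b μ)) {r₁ r₂ : LegFam d} {C₁ T₁ C₂ : ℝ} (h₁ : LegL1 r₁ C₁ T₁)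
    (h₂ : ∀ lam v κ u, |r₂ lam v κ u| ≤ C₂) : legAct (legComp r₂ r₁) b = legAct r₂ (legAct r₁ b) := by
  have hC₂ : 0 ≤ C₂ := (abs_nonneg _).trans (h₂ 0 0 0 0)
  funext κ u
  -- product summability of `(y, v) ↦ b μ y · r₁ μ y λ v · r₂ λ v κ u` for each `μ, λ`
  have hpl : ∀ μ lam, Summable (Function.uncurry fun y v => b μ y * (r₁ μ y lam v * r₂ lam v κ u)) := by
    intro μ lam
    refine (summable_uncurry_of_majorant (F := fun y v => b μ y * (r₁ μ y lam v * r₂ lam v κ u))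
      (G := fun y v => |b μ y| * C₂ * |r₁ μ y lam v|) (fun y v => by have := h₁.nonneg; positivity)
      (fun y => (h₁.summable_abs μ y lam).mul_left _) ((hb μ).abs.mul_right (C₂ * T₁)) (fun y => ?_) (fun y v => ?_)).1
    · show ∑' v, |b μ y| * C₂ * |r₁ μ y lam v| ≤ |b μ y| * (C₂ * T₁)
      rw [tsum_mul_left, mul_assoc]
      exact mul_le_mul_of_nonneg_left (mul_le_mul_of_nonneg_left (h₁.tsum_abs_le μ y lam) hC₂) (abs_nonneg _)
    · show |b μ y * (r₁ μ y lam v * r₂ lam v κ u)| ≤ |b μ y| * C₂ * |r₁ μ y lam v|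
      rw [abs_mul, abs_mul]
      calc |b μ y| * (|r₁ μ y lam v| * |r₂ lam v κ u|) ≤ |b μ y| * (|r₁ μ y lam v| * C₂) :=
            mul_le_mul_of_nonneg_left (mul_le_mul_of_nonneg_left (h₂ lam v κ u) (abs_nonneg _)) (abs_nonneg _)
        _ = |b μ y| * C₂ * |r₁ μ y lam v| := by ring
  have hprod : ∀ μ, Summable (Function.uncurry fun y v => ∑ lam, b μ y * (r₁ μ y lam v * r₂ lam v κ u)) := fun μ =>
    (summable_sum (s := Finset.univ) fun lam _ => hpl μ lam).congr fun p => by simp only [Function.uncurry]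
  -- the `y`-slices and the `v`-marginals
  have hy : ∀ μ lam v, Summable fun y => b μ y * (r₁ μ y lam v * r₂ lam v κ u) := fun μ lam v =>
    summable_mul_of_bdd' (hb μ) (M := C₁ * C₂) fun y => by
      rw [abs_mul]; exact mul_le_mul (h₁.abs_le μ y lam v) (h₂ lam v κ u) (abs_nonneg _) h₁.nonneg
  have hv : ∀ μ lam, Summable fun v => ∑' y, b μ y * (r₁ μ y lam v * r₂ lam v κ u) := fun μ lam => (hpl μ lam).prod_symm.prod
  -- LEFT: `Σ_μ Σ'_y b · (Σ'_v Σ_λ r₁ r₂) = Σ'_v Σ_μ Σ_λ Σ'_y b r₁ r₂`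
  have lhs : ∀ μ, (∑' y, b μ y * legComp r₂ r₁ μ y κ u) = ∑' v, ∑ lam, ∑' y, b μ y * (r₁ μ y lam v * r₂ lam v κ u) := by
    intro μ
    have e1 : ∀ y, b μ y * legComp r₂ r₁ μ y κ u = ∑' v, ∑ lam, b μ y * (r₁ μ y lam v * r₂ lam v κ u) := by
      intro y
      rw [legComp_apply, ← tsum_mul_left]
      exact tsum_congr fun v => Finset.mul_sum _ _ _
    have swap : ∑' y, ∑' v, (∑ lam, b μ y * (r₁ μ y lam v * r₂ lam v κ u)) = ∑' v, ∑' y, ∑ lam, b μ y * (r₁ μ y lam v * r₂ lam v κ u) :=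
      ((hprod μ).tsum_comm).symm
    rw [tsum_congr e1, swap]
    exact tsum_congr fun v => Summable.tsum_finsetSum fun lam _ => hy μ lam v
  -- RIGHT: `Σ_λ Σ'_v (Σ_μ Σ'_y b r₁) · r₂ = Σ'_v Σ_λ Σ_μ Σ'_y b r₁ r₂`
  have rhs : ∀ lam, (∑' v, legAct r₁ b lam v * r₂ lam v κ u) = ∑' v, ∑ μ, ∑' y, b μ y * (r₁ μ y lam v * r₂ lam v κ u) := by
    intro lam
    refine tsum_congr fun v => ?_
    rw [legAct_apply, Finset.sum_mul]
    refine Finset.sum_congr rfl fun μ _ => ?_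
    rw [← tsum_mul_right]
    exact tsum_congr fun y => by ring
  rw [legAct_apply, legAct_apply, Finset.sum_congr rfl fun μ _ => lhs μ, Finset.sum_congr rfl fun lam _ => rhs lam,
    ← Summable.tsum_finsetSum (fun μ _ => summable_sum fun lam _ => hv μ lam),
    ← Summable.tsum_finsetSum (fun lam _ => summable_sum fun μ _ => hv μ lam)]
  exact tsum_congr fun v => Finset.sum_comm

/-- [folklore] **an2's RESPONSE FAMILIES ARE IN THE CLASS** (`N′ = M·L`; NO decay rate): bounded (`exists_abs_respStep_le`), summable in the fine index
(`summable_respStep`), and the `ℓ¹` mass is INDEPENDENT of the source bond by the joint block covariance `respStep_translate`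
(`respStep M N′ μ y κ u = respStep M N′ μ 0 κ (u − L•y)`). -/
theorem exists_legL1_respStep {M L N' : ℕ} [NeZero M] [NeZero N'] (hN' : N' = M * L) :
    ∃ C T : ℝ, LegL1 (respStep (d := d) M N') C T := by
  obtain ⟨C, hC⟩ := exists_abs_respStep_le (N' := N') (d := d) M
  refine ⟨C, ∑ μ' : Fin (d + 1), ∑ κ' : Fin (d + 1), ∑' u, |respStep (d := d) M N' μ' 0 κ' u|, fun μ y κ u => hC μ y κ u,
    fun μ y κ => ⟨summable_respStep M N' μ y κ, ?_⟩⟩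
  have ht : ∀ u, respStep (d := d) M N' μ y κ u = respStep (d := d) M N' μ 0 κ (u - (L : ℤ) • y) := by
    intro u
    have h := respStep_translate (d := d) (M := M) (L := L) hN' μ 0 κ (u - (L : ℤ) • y) y
    rw [zero_add, sub_add_cancel] at h
    exact h
  have e : ∑' u, |respStep (d := d) M N' μ y κ u| = ∑' u, |respStep (d := d) M N' μ 0 κ u| := by
    simp_rw [ht]
    exact (Equiv.subRight ((L : ℤ) • y)).tsum_eq (fun u => |respStep (d := d) M N' μ 0 κ u|)
  rw [e]
  refine le_trans ?_ (Finset.single_le_sum (f := fun μ' => ∑ κ' : Fin (d + 1), ∑' u, |respStep (d := d) M N' μ' 0 κ' u|)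
    (fun _ _ => Finset.sum_nonneg fun _ _ => tsum_nonneg fun _ => abs_nonneg _) (Finset.mem_univ μ))
  exact Finset.single_le_sum (f := fun κ' => ∑' u, |respStep (d := d) M N' μ 0 κ' u|)
    (fun _ _ => tsum_nonneg fun _ => abs_nonneg _) (Finset.mem_univ κ)

/-- [folklore] **THE WINDOW KEEPS THE CLASS** (in-block root, `N ≥ 1`): `LegL1 r C T ⟹ LegL1 (bmW (toSite rr) N r) (cWb d N · C) (cWb d N · T)` —
`(2N+1)^{d+1}·(d+1)` window terms, matrix bound `|pmBm| ≤ 1 + 4(d+1)N` (an2's `abs_pmBm_le`), translation invariance of the `ℓ¹` mass. -/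
theorem legL1_bmW {r : LegFam d} {C T : ℝ} (hr : LegL1 r C T) {N : ℕ} (hN : 1 ≤ N) {rr : Fin (d + 1) → ℕ}
    (hrr : rr ∈ box (d + 1) N) : LegL1 (bmW (toSite rr) N r) (cWb d N * C) (cWb d N * T) := by
  set P : ℝ := 1 + 4 * (((d : ℝ) + 1) * N) with hP
  have hP0 : 0 ≤ P := by positivity
  have hpm : ∀ κ u κ' q, |pmBm (toSite rr) N κ u κ' q| ≤ P := fun κ u κ' q => abs_pmBm_le hN hrr κ u κ' q
  have hconst : ∀ X : ℝ, (∑ _v ∈ cube (d + 1) N, ∑ _κ' : Fin (d + 1), P * X) = cWb d N * X := by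
    intro X
    rw [Finset.sum_const, Finset.sum_const, Finset.card_univ, Fintype.card_fin, card_cube, smul_smul, nsmul_eq_mul]
    unfold cWb
    push_cast
    ring
  have hsum : ∀ μ y κ, Summable (bmW (toSite rr) N r μ y κ) := by
    intro μ y κ
    show Summable fun u => bmW (toSite rr) N r μ y κ u
    simp only [bmW_apply]
    exact summable_sum fun v _ => summable_sum fun κ' _ =>
      summable_mul_of_bdd (fun u => hpm κ u κ' (u - v)) (summable_shift_sub (hr.summable μ y κ') v)
  have hs' : ∀ μ y v κ', Summable fun u => P * |r μ y κ' (u - v)| := fun μ y v κ' =>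
    (summable_shift_sub (hr.summable_abs μ y κ') v).mul_left P
  refine ⟨fun μ y κ u => ?_, fun μ y κ => ⟨hsum μ y κ, ?_⟩⟩
  · rw [bmW_apply, ← hconst C]
    exact (Finset.abs_sum_le_sum_abs _ _).trans (Finset.sum_le_sum fun v _ => (Finset.abs_sum_le_sum_abs _ _).trans
      (Finset.sum_le_sum fun κ' _ => by
        rw [abs_mul]; exact mul_le_mul (hpm _ _ _ _) (hr.abs_le _ _ _ _) (abs_nonneg _) hP0))
  · calc ∑' u, |bmW (toSite rr) N r μ y κ u| ≤ ∑' u, ∑ v ∈ cube (d + 1) N, ∑ κ', P * |r μ y κ' (u - v)| :=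
          Summable.tsum_le_tsum (fun u => by
            rw [bmW_apply]
            exact (Finset.abs_sum_le_sum_abs _ _).trans (Finset.sum_le_sum fun v _ => (Finset.abs_sum_le_sum_abs _ _).trans
              (Finset.sum_le_sum fun κ' _ => by rw [abs_mul]; exact mul_le_mul_of_nonneg_right (hpm _ _ _ _) (abs_nonneg _))))
            (hsum μ y κ).abs (summable_sum fun v _ => summable_sum fun κ' _ => hs' μ y v κ')
      _ = ∑ v ∈ cube (d + 1) N, ∑ κ', ∑' u, P * |r μ y κ' (u - v)| := by
          rw [Summable.tsum_finsetSum (fun v _ => summable_sum fun κ' _ => hs' μ y v κ')]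
          exact Finset.sum_congr rfl fun v _ => Summable.tsum_finsetSum fun κ' _ => hs' μ y v κ'
      _ = ∑ v ∈ cube (d + 1) N, ∑ κ' : Fin (d + 1), P * ∑' u, |r μ y κ' u| :=
          Finset.sum_congr rfl fun v _ => Finset.sum_congr rfl fun κ' _ => by
            rw [tsum_mul_left]
            congr 1
            exact (Equiv.subRight v).tsum_eq (fun u => |r μ y κ' u|)
      _ ≤ ∑ _v ∈ cube (d + 1) N, ∑ _κ' : Fin (d + 1), P * T :=
          Finset.sum_le_sum fun v _ => Finset.sum_le_sum fun κ' _ => mul_le_mul_of_nonneg_left (hr.tsum_abs_le μ y κ') hP0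
      _ = cWb d N * T := hconst T


end Summit.QuantumFields.BalabanUV.Beta.GAN24.RespStepBmDecompLegs

end
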